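import Summits.QuantumFields.YangMills.Theorems.ForcedResponseSkewnessResponseLocalisationCentredOscToolkit
import Summits.QuantumFields.YangMills.Theorems.ForcedResponseSkewnessResponseLocalisationSignedKernelPerSite
import Summits.QuantumFields.YangMills.Theorems.ForcedResponseSkewnessRunningCouplingCeilingDefs
import HarnessLib

/-!
# Route `ForcedResponseSkewness`, crux `RunningCouplingCeiling` (stmt-QuantumFields-24275), line «pointwise-log-ceiling-r»:
# the AF stub `FemtoLogSigR` only needs the CENTRE of CENTRED cubes

Helper file (`--supports stmt-QuantumFields-24275`) of the lead prover `ym-line-frs-p1` (g5); the two-point twin of the deciding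
crux's reduction `CentredOsc.symNearCovLaw_of_centredOsc` (same toolkit `…ResponseLocalisationCentredOscToolkit.lean`).  The
registered AF stub `stub_femtoLog : FemtoLogSigR` (`Theorems/ForcedResponseSkewnessRunningCouplingCeilingDefs.lean`) asks, on EVERY
femto cube `Q`, for EVERY exterior and EVERY pair `x, y` at collar depth `K(s)·‖y−x‖` (`s = ‖y−x‖·a β`), the log two-point ceiling
`‖y−x‖⁸ |kerCov_η^Q(dens x, dens y)| ≤ C₂ / log²(1/s)`.  Here:

* `femtoLog_of_centred` — for a unit map `0 < a β → 0` with the frozen-boundary law `FBL G r a` it suffices to have the ceiling at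
  the CENTRE of the centred cubes `[-N, N]⁴` only: pairs `(0, y)` with `(K(s)+1)·‖y‖ ≤ N+1` (so that both ends sit at depth
  `≥ K(s)‖y‖`), every exterior, `‖y‖⁸ |kerCov_η^{[-N,N]⁴}(dens 0, dens y)| ≤ C₂ / log²(1/(‖y‖·a β))`.  The general cube follows by the
  law of total covariance through the centred sub-cube of radius `depth x − 1` around `x` (`abs_kerCov_sub_kerE_kerCov_le`): the
  covariance of the sub-cube kernel MEANS is `≤ 4 C₁²/(depth'_x⁴ depth'_y⁴) ≤ 4C₁²/((K'‖y−x‖)⁴((K'−1)‖y−x‖)⁴)` and is absorbed into the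
  log ceiling by enlarging the collar depth to `K'(s) = 2K(s) + 2 + max 0 (log(1/s))` (still `s·K'(s) → 0`) and the constant to
  `C₂ + 4C₁²` (femto scale `min (min ℓ₂ ℓ₁) 1`, so that `s ≤ 3/4` and `log(1/s) > 0`);
* `femtoLogSigR_of_centred` — the pinned form: `FBLPinnedSigR` + the pinned centred ceiling ⇒ `FemtoLogSigR` BY NAME.

So both AF debts of the route (`CentredOscLaw` for 26871, the centred log ceiling for 24275) are statements about ONE family of cubes,
at the centre, for arbitrary exteriors — the geometry of the spine's engine statements E1/E2.  No summit is proved by any of this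
(leaf R2a `BalabanLadder.NT`, conditional rung line; the log ceiling (asymptotic freedom, two-point, uniformly in the exterior —
Bałaban-class, not in print), the crux, NT and the YM mass gap are NOT proved).
-/

set_option autoImplicit false

noncomputable section

open scoped SchwartzMap
open MeasureTheory Filter Topology
open Literature.MathematicalPhysics.QuantumFieldTheory Literature.MathematicalPhysics.QuantumLattice
open Literature.Probability.LatticeModels
open Summit.QuantumFields.YangMills.Cruxes.OSLegsFromFemtoAndGap.DlrCollarTransfer
open Summit.QuantumFields.YangMills.Cruxes.NT.BoundaryLaw
open Summit.QuantumFields.YangMills.Cruxes.ResponseLocalisation.Birth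
open Summit.QuantumFields.YangMills.Cruxes.ResponseLocalisation.CentredOsc
open Summit.QuantumFields.YangMills.Cruxes.ResponseLocalisation.Smeared (kerCov_comm)
open Summit.QuantumFields.YangMills.Cruxes.RunningCouplingCeiling.Pointwise (FemtoLogSigR)

namespace Summit.QuantumFields.YangMills.Cruxes.RunningCouplingCeiling.CentredLog

/-! ## Arithmetic and the enlarged collar depth -/

/-- The enlarged collar depth `K'(s) = 2K(s) + 2 + max 0 (log (1/s))` still satisfies `s·K'(s) → 0` as `s → 0⁺`. [folklore] -/
theorem tendsto_mul_enlargedDepth {K : ℝ → ℝ}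
    (hK : Tendsto (fun s : ℝ => s * K s) (nhdsWithin 0 (Set.Ioi 0)) (nhds 0)) :
    Tendsto (fun s : ℝ => s * (2 * K s + 2 + max 0 (Real.log (1 / s)))) (nhdsWithin 0 (Set.Ioi 0)) (nhds 0) := by
  have h2 : Tendsto (fun s : ℝ => s) (nhdsWithin 0 (Set.Ioi 0)) (nhds 0) :=
    tendsto_nhdsWithin_of_tendsto_nhds tendsto_id
  have h3 : Tendsto (fun s : ℝ => s * max 0 (Real.log (1 / s))) (nhdsWithin 0 (Set.Ioi 0)) (nhds 0) := by
    have hlog := (tendsto_log_mul_rpow_nhdsGT_zero one_pos).neg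
    rw [neg_zero] at hlog
    refine hlog.congr' ?_
    filter_upwards [Ioo_mem_nhdsGT (zero_lt_one' ℝ)] with s hs
    have hs0 : 0 < s := hs.1
    have hlog_nonpos : Real.log s ≤ 0 := Real.log_nonpos hs0.le hs.2.le
    have hmax : max 0 (Real.log (1 / s)) = -Real.log s := by
      rw [one_div, Real.log_inv]
      exact max_eq_right (by linarith)
    rw [hmax, Real.rpow_one]
    ring
  have hsum := (hK.const_mul 2).add ((h2.const_mul 2).add h3)
  simp only [mul_zero, add_zero] at hsum
  refine hsum.congr' (Eventually.of_forall fun s => ?_)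
  simp only
  ring

/-- `log²(1/s) ≤ (K'·(K'−1))⁴` once `2 + log(1/s) ≤ K'`, `3 ≤ K'` and `0 < log(1/s)`. [folklore] -/
theorem log_sq_le_depth_pow {ℓg K' : ℝ} (hℓg : 0 < ℓg) (hK : 2 + ℓg ≤ K') (hK3 : 3 ≤ K') :
    ℓg ^ 2 ≤ (K' * (K' - 1)) ^ 4 := by
  set P := K' * (K' - 1) with hP
  have hK2 : 2 ≤ K' - 1 := by linarith [hK3]
  have hP1 : 1 ≤ P := by rw [hP]; nlinarith [hK2]
  have hPℓ : ℓg ≤ P := by rw [hP]; nlinarith [hK2, hK]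
  have h1 : ℓg ^ 2 ≤ P ^ 2 := pow_le_pow_left₀ hℓg.le hPℓ 2
  have h2 : P ^ 2 ≤ P ^ 4 := pow_le_pow_right₀ hP1 (by norm_num)
  exact h1.trans h2

/-- The second-order remainder of the law of total covariance is absorbed into the log ceiling:
`n⁸ · 4 · (C₁/m⁴) · (C₁/(m−n)⁴) ≤ 4C₁²/log²` when `K'·n ≤ m`, `log² ≤ (K'(K'−1))⁴`, `3 ≤ K'`, `0 < n`. [folklore] -/
theorem remainder_le_log {C₁ m n K' ℓg : ℝ} (hC₁ : 0 ≤ C₁) (hn : 0 < n) (hK3 : 3 ≤ K') (hm : K' * n ≤ m) (hℓg : 0 < ℓg)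
    (hlog : ℓg ^ 2 ≤ (K' * (K' - 1)) ^ 4) :
    n ^ 8 * (4 * (C₁ / m ^ 4) * (C₁ / (m - n) ^ 4)) ≤ 4 * C₁ ^ 2 / ℓg ^ 2 := by
  have hKn : 0 < K' * n := by positivity
  have hKn' : 0 < (K' - 1) * n := mul_pos (by linarith [hK3]) hn
  have hm0 : 0 < m := by linarith
  have hmn : (K' - 1) * n ≤ m - n := by linarith
  have hmn0 : 0 < m - n := by linarith
  have h1 : C₁ / m ^ 4 ≤ C₁ / (K' * n) ^ 4 :=
    div_le_div_of_nonneg_left hC₁ (by positivity) (pow_le_pow_left₀ hKn.le hm 4)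
  have h2 : C₁ / (m - n) ^ 4 ≤ C₁ / ((K' - 1) * n) ^ 4 :=
    div_le_div_of_nonneg_left hC₁ (by positivity) (pow_le_pow_left₀ hKn'.le hmn 4)
  have h3 : n ^ 8 * (4 * (C₁ / m ^ 4) * (C₁ / (m - n) ^ 4)) ≤
      n ^ 8 * (4 * (C₁ / (K' * n) ^ 4) * (C₁ / ((K' - 1) * n) ^ 4)) := by
    apply mul_le_mul_of_nonneg_left _ (by positivity)
    exact mul_le_mul (mul_le_mul_of_nonneg_left h1 (by norm_num)) h2 (by positivity) (by positivity)
  have e : n ^ 8 * (4 * (C₁ / (K' * n) ^ 4) * (C₁ / ((K' - 1) * n) ^ 4)) = 4 * C₁ ^ 2 / (K' * (K' - 1)) ^ 4 := by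
    field_simp
  rw [e] at h3
  exact h3.trans (div_le_div_of_nonneg_left (by positivity) (by positivity) hlog)

/-! ## The reduction -/

section Reduction

variable (G : Type) [Group G] [TopologicalSpace G] [IsTopologicalGroup G] [CompactSpace G]
  [MeasurableSpace G] [BorelSpace G] (r : LatticeRep G)

/-- **The femto log two-point ceiling from `FBL` and the ceiling at the CENTRE of CENTRED cubes.**  For a unit map `0 < a β → 0`
with `FBL G r a`: if for some `ℓ₂, C₂, β₂`, collar depth `K ≥ 1` with `s·K(s) → 0` and `n₀` the log ceiling
`‖y‖⁸ |kerCov_η^{[-N,N]⁴}(dens 0, dens y)| ≤ C₂ / log²(1/(‖y‖·a β))` holds for `β ≥ β₂`, every radius `N` with `(2N+1)·a β ≤ ℓ₂`, every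
exterior `η` and every `y` with `n₀ ≤ ‖y‖`, `(K(‖y‖ a β) + 1)·‖y‖ ≤ N+1`, then the body of the registered stub `FemtoLogSigR` holds for
`(G, r, a)` (all femto cubes, all pairs; femto scale `min (min ℓ₂ ℓ₁) 1`, constant `C₂ + 4C₁²`, collar depth `2K + 2 + max 0 log(1/s)`,
`n₀ ↦ max n₀ 1`). [folklore] -/
theorem femtoLog_of_centred (a : ℝ → ℝ) (ha : ∀ β, 0 < a β) (hlim : Tendsto a atTop (𝓝 0)) (hFBL : FBL G r a)
    (hcen : ∃ (ℓ₂ C₂ β₂ : ℝ) (K : ℝ → ℝ) (n₀ : ℕ), 0 < ℓ₂ ∧ (∀ s, 1 ≤ K s) ∧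
      Filter.Tendsto (fun s : ℝ => s * K s) (nhdsWithin 0 (Set.Ioi 0)) (nhds 0) ∧
      ∀ β : ℝ, β₂ ≤ β → ∀ N : ℕ, ((2 * N + 1 : ℕ) : ℝ) * a β ≤ ℓ₂ →
        ∀ (η : LGConfig 4 G) (y : Fin 4 → ℤ), (n₀ : ℝ) ≤ ‖siteToE y‖ →
          (K (‖siteToE y‖ * a β) + 1) * ‖siteToE y‖ ≤ (N : ℝ) + 1 →
            ‖siteToE y‖ ^ 8 * |kerCov G r β (fun _ => -(N : ℤ)) (2 * N + 1) η (dens G r 0) (dens G r y)| ≤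
              C₂ / Real.log (1 / (‖siteToE y‖ * a β)) ^ 2) :
    ∃ (ℓ₂ C₂ β₂ : ℝ) (K : ℝ → ℝ) (n₀ : ℕ), 0 < ℓ₂ ∧ (∀ s, 1 ≤ K s) ∧
      Filter.Tendsto (fun s : ℝ => s * K s) (nhdsWithin 0 (Set.Ioi 0)) (nhds 0) ∧
      ∀ β : ℝ, β₂ ≤ β → ∀ (c : Fin 4 → ℤ) (b : ℕ), (b : ℝ) * a β ≤ ℓ₂ →
        ∀ (η : LGConfig 4 G) (x y : Fin 4 → ℤ), (n₀ : ℝ) ≤ ‖siteToE (y - x)‖ →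
          K (‖siteToE (y - x)‖ * a β) * ‖siteToE (y - x)‖ ≤ (depth c b x : ℝ) →
          K (‖siteToE (y - x)‖ * a β) * ‖siteToE (y - x)‖ ≤ (depth c b y : ℝ) →
            ‖siteToE (y - x)‖ ^ 8 * |kerCov G r β c b η (dens G r x) (dens G r y)| ≤
              C₂ / Real.log (1 / (‖siteToE (y - x)‖ * a β)) ^ 2 := by
  obtain ⟨ℓ₂, C₂, β₂, K, n₀, hℓ₂, hK1, hKlim, H⟩ := hcen
  obtain ⟨C₁, β₁, ℓ₁, p, hℓ₁, hC₁, hF⟩ := hFBL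
  -- threshold `a β ≤ 1/2`
  obtain ⟨βa, hβa⟩ : ∃ βa : ℝ, ∀ β, βa ≤ β → a β ≤ 1 / 2 := by
    have hev : ∀ᶠ β in atTop, a β < 1 / 2 := (tendsto_order.1 hlim).2 _ (by norm_num)
    obtain ⟨βa, hβa⟩ := eventually_atTop.1 hev
    exact ⟨βa, fun β hβ => (hβa β hβ).le⟩
  refine ⟨min (min ℓ₂ ℓ₁) 1, C₂ + 4 * C₁ ^ 2, max (max β₂ β₁) βa,
    fun s => 2 * K s + 2 + max 0 (Real.log (1 / s)), max n₀ 1,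
    lt_min (lt_min hℓ₂ hℓ₁) one_pos, fun s => ?_, tendsto_mul_enlargedDepth hKlim, ?_⟩
  · have := hK1 s
    have : 0 ≤ max 0 (Real.log (1 / s)) := le_max_left _ _
    linarith
  intro β hβ c b hb η x y hn₀ hKx hKy
  have hβ₂ : β₂ ≤ β := le_trans (le_trans (le_max_left _ _) (le_max_left _ _)) hβ
  have hβ₁ : β₁ ≤ β := le_trans (le_trans (le_max_right _ _) (le_max_left _ _)) hβ
  have haβ2 : a β ≤ 1 / 2 := hβa β (le_trans (le_max_right _ _) hβ)
  have haβ : 0 < a β := ha β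
  -- notation: `v = y − x`, `nv = ‖v‖ ≥ 1`, `s = nv·aβ ∈ (0, 3/4]`, `ℓg = log(1/s) > 0`, `K' = K'(s) ≥ 3`
  set v : Fin 4 → ℤ := y - x with hv_def
  set nv : ℝ := ‖siteToE v‖ with hnv_def
  set K' : ℝ := 2 * K (nv * a β) + 2 + max 0 (Real.log (1 / (nv * a β))) with hK'_def
  set ℓg : ℝ := Real.log (1 / (nv * a β)) with hℓg_def
  have hn₀' : ((max n₀ 1 : ℕ) : ℝ) ≤ nv := hn₀
  have hnv1 : 1 ≤ nv := le_trans (by exact_mod_cast le_max_right n₀ 1) hn₀'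
  have hnv0 : 0 < nv := by linarith
  have hn₀nv : (n₀ : ℝ) ≤ nv := le_trans (by exact_mod_cast le_max_left n₀ 1) hn₀'
  have hKs : 1 ≤ K (nv * a β) := hK1 _
  have hmax0 : 0 ≤ max 0 (Real.log (1 / (nv * a β))) := le_max_left _ _
  have hK'3 : 3 ≤ K' := by rw [hK'_def]; linarith
  have hK'ℓ : 2 + ℓg ≤ K' := by
    have : ℓg ≤ max 0 (Real.log (1 / (nv * a β))) := le_max_right _ _
    rw [hK'_def]; linarith
  have hK'K : K (nv * a β) + 1 ≤ K' - 1 := by rw [hK'_def]; linarith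
  -- the depth `m = depth x ≥ K' nv` and the centred sub-cube `Q'` of radius `N = m − 1` around `x`
  have hmK : K' * nv ≤ (depth c b x : ℝ) := hKx
  have h3nv : 3 * nv ≤ K' * nv := mul_le_mul_of_nonneg_right hK'3 hnv0.le
  have hm3 : (3 : ℝ) ≤ (depth c b x : ℝ) := by linarith only [hmK, h3nv, hnv1]
  obtain ⟨N, hN⟩ : ∃ N : ℕ, depth c b x = N + 1 :=
    ⟨depth c b x - 1, by
      have h1 : 1 ≤ depth c b x := by exact_mod_cast (show (1 : ℝ) ≤ (depth c b x : ℝ) by linarith)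
      omega⟩
  have hmN : ((depth c b x : ℕ) : ℝ) = (N : ℝ) + 1 := by rw [hN]; push_cast; ring
  set m : ℝ := (N : ℝ) + 1 with hm_def
  rw [hmN] at hmK hm3
  have hyN : N + 1 ≤ depth c b x := hN.ge
  have hsub : cubeEdges (fun j => x j - N) (2 * N + 1) ⊆ cubeEdges c b :=
    cubeEdges_subset (centredCube_subset_of_le_depth hyN)
  have h2N1 : 2 * N + 1 ≤ b := two_mul_add_one_le_of_le_depth hyN
  have hside : ((2 * N + 1 : ℕ) : ℝ) * a β ≤ min (min ℓ₂ ℓ₁) 1 :=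
    (mul_le_mul_of_nonneg_right (by exact_mod_cast h2N1) haβ.le).trans hb
  have hsideℓ₂ : ((2 * N + 1 : ℕ) : ℝ) * a β ≤ ℓ₂ := hside.trans ((min_le_left _ _).trans (min_le_left _ _))
  have hsideℓ₁ : ((2 * N + 1 : ℕ) : ℝ) * a β ≤ ℓ₁ := hside.trans ((min_le_left _ _).trans (min_le_right _ _))
  have hside1 : ((2 * N + 1 : ℕ) : ℝ) * a β ≤ 1 := hside.trans (min_le_right _ _)
  -- `s = nv·aβ ≤ 3/4`, hence `ℓg > 0`
  have hs0 : 0 < nv * a β := by positivity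
  have hs34 : nv * a β ≤ 3 / 4 := by
    have h1 : nv ≤ m := by linarith only [hmK, h3nv, hnv0]
    have h2 : 2 * m * a β ≤ 1 + a β := by
      have e2 : 2 * m * a β = ((2 * N + 1 : ℕ) : ℝ) * a β + a β := by rw [hm_def]; push_cast; ring
      rw [e2]; linarith only [hside1]
    have h3 : nv * a β ≤ m * a β := mul_le_mul_of_nonneg_right h1 haβ.le
    linarith only [h2, h3, haβ2]
  have hℓg : 0 < ℓg := by
    rw [hℓg_def]
    apply Real.log_pos
    rw [lt_div_iff₀ hs0]; linarith
  -- depths in `Q'`: `x` at depth `≥ m`, `y = x + v` at depth `≥ m − nv`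
  have hyv : y = x + v := by rw [hv_def]; abel
  have hdx : m ≤ (depth (fun j => x j - N) (2 * N + 1) x : ℝ) := le_depth_centre x N
  have hdy : m - nv ≤ (depth (fun j => x j - N) (2 * N + 1) y : ℝ) := by
    have := le_depth_centred_of_norm_le x v N (le_refl nv)
    rwa [← hyv] at this
  have hmnv : 2 * nv ≤ m - nv := by linarith only [hmK, h3nv]
  have h2x : 2 ≤ depth (fun j => x j - N) (2 * N + 1) x := by
    have : (2 : ℝ) ≤ (depth (fun j => x j - N) (2 * N + 1) x : ℝ) := by linarith
    exact_mod_cast this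
  have h2y : 2 ≤ depth (fun j => x j - N) (2 * N + 1) y := by
    have : (2 : ℝ) ≤ (depth (fun j => x j - N) (2 * N + 1) y : ℝ) := by linarith
    exact_mod_cast this
  -- the boundary laws in `Q'`
  have hx : ∀ ξ : LGConfig 4 G, |kerE G r β (fun j => x j - N) (2 * N + 1) ξ (dens G r x) - p β| ≤ C₁ / m ^ 4 :=
    fun ξ => (hF β hβ₁ _ _ hsideℓ₁ ξ x h2x).trans
      (div_le_div_of_nonneg_left hC₁ (by positivity) (pow_le_pow_left₀ (by positivity) hdx 4))
  have hy : ∀ ξ : LGConfig 4 G, |kerE G r β (fun j => x j - N) (2 * N + 1) ξ (dens G r y) - p β| ≤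
      C₁ / (m - nv) ^ 4 :=
    fun ξ => (hF β hβ₁ _ _ hsideℓ₁ ξ y h2y).trans
      (div_le_div_of_nonneg_left hC₁ (pow_pos (by linarith) 4) (pow_le_pow_left₀ (by linarith) hdy 4))
  -- law of total covariance through `Q'`
  have htc := abs_kerCov_sub_kerE_kerCov_le G r β hsub η x y hx hy
  -- the centred ceiling in `Q'` (translated to the origin), uniformly in the exterior
  have hinner : ∀ ξ : LGConfig 4 G,
      |kerCov G r β (fun j => x j - N) (2 * N + 1) ξ (dens G r x) (dens G r y)| ≤ C₂ / ℓg ^ 2 / nv ^ 8 := by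
    intro ξ
    have e : kerCov G r β (fun j => x j - N) (2 * N + 1) ξ (dens G r x) (dens G r y) =
        kerCov G r β (fun _ => -(N : ℤ)) (2 * N + 1) (configShift (-x) ξ) (dens G r 0) (dens G r v) := by
      rw [kerCov_comm r, hyv, kerCov_dens_centred_eq, kerCov_comm r]
    rw [e]
    have hKv : (K (nv * a β) + 1) * nv ≤ (N : ℝ) + 1 := by
      have h5 : (K (nv * a β) + 1) * nv ≤ (K' - 1) * nv := mul_le_mul_of_nonneg_right hK'K hnv0.le
      have e5 : (K' - 1) * nv = K' * nv - nv := by ring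
      linarith only [h5, e5, hmK, hnv0, hm_def]
    have key := H β hβ₂ N hsideℓ₂ (configShift (-x) ξ) v hn₀nv hKv
    rw [le_div_iff₀ (by positivity : (0 : ℝ) < nv ^ 8)]
    linarith [key]
  have hcont : Continuous fun ξ : LGConfig 4 G =>
      kerCov G r β (fun j => x j - N) (2 * N + 1) ξ (dens G r x) (dens G r y) :=
    continuous_kerCov_dens G r β _ _ x y
  have havg : |kerE G r β c b η (fun ξ => kerCov G r β (fun j => x j - N) (2 * N + 1) ξ (dens G r x) (dens G r y))|
      ≤ C₂ / ℓg ^ 2 / nv ^ 8 :=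
    abs_kerE_le G r β c b η hinner
  -- assemble
  have hrem := remainder_le_log (m := m) hC₁ hnv0 hK'3 hmK hℓg (log_sq_le_depth_pow hℓg hK'ℓ hK'3)
  have htri : |kerCov G r β c b η (dens G r x) (dens G r y)| ≤
      C₂ / ℓg ^ 2 / nv ^ 8 + 4 * (C₁ / m ^ 4) * (C₁ / (m - nv) ^ 4) := by
    have h1 := abs_sub_abs_le_abs_sub (kerCov G r β c b η (dens G r x) (dens G r y))
      (kerE G r β c b η (fun ξ => kerCov G r β (fun j => x j - N) (2 * N + 1) ξ (dens G r x) (dens G r y)))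
    linarith
  have hnv8 : 0 < nv ^ 8 := by positivity
  calc nv ^ 8 * |kerCov G r β c b η (dens G r x) (dens G r y)|
      ≤ nv ^ 8 * (C₂ / ℓg ^ 2 / nv ^ 8 + 4 * (C₁ / m ^ 4) * (C₁ / (m - nv) ^ 4)) :=
        mul_le_mul_of_nonneg_left htri hnv8.le
    _ = C₂ / ℓg ^ 2 + nv ^ 8 * (4 * (C₁ / m ^ 4) * (C₁ / (m - nv) ^ 4)) := by
        field_simp
    _ ≤ C₂ / ℓg ^ 2 + 4 * C₁ ^ 2 / ℓg ^ 2 := by linarith [hrem]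
    _ = (C₂ + 4 * C₁ ^ 2) / ℓg ^ 2 := by rw [← add_div]

/-- **Pinned form**: along a unit pinned by a compactly supported positive-time floor witness, the frozen-boundary law
`FBLPinnedSigR` (the tree's `fblPinnedSigR_of_fbl6 ∘ stub_fbl6Pinned`) and the log ceiling at the centre of centred cubes give
the registered AF stub statement `FemtoLogSigR` BY NAME. [folklore] -/
theorem femtoLogSigR_of_centred (hFBL : FBLPinnedSigR)
    (hcen : ∀ (G : Type) [Group G] [TopologicalSpace G] [IsTopologicalGroup G] [CompactSpace G],
      IsCompactSimpleLieGroup G →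
      letI : MeasurableSpace G := borel G
      haveI : BorelSpace G := ⟨rfl⟩
      ∀ (r : LatticeRep G) (a : ℝ → ℝ), (∀ β, 0 < a β) → Filter.Tendsto a Filter.atTop (nhds 0) →
        (∃ (v₀ : 𝓢(EuclideanSpace ℝ (Fin 4), ℝ)) (ε β₅ Λ₅ : ℝ), HasCompactSupport v₀ ∧
          tsupport v₀ ⊆ {y : EuclideanSpace ℝ (Fin 4) | 0 < y 0} ∧ 0 < ε ∧
          ∀ β : ℝ, β₅ ≤ β → ∀ L : ℕ, Λ₅ ≤ a β * L → ε ≤ Q2 G r β L (a β) (thetaTest 4 v₀) v₀) →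
        ∃ (ℓ₂ C₂ β₂ : ℝ) (K : ℝ → ℝ) (n₀ : ℕ), 0 < ℓ₂ ∧ (∀ s, 1 ≤ K s) ∧
          Filter.Tendsto (fun s : ℝ => s * K s) (nhdsWithin 0 (Set.Ioi 0)) (nhds 0) ∧
          ∀ β : ℝ, β₂ ≤ β → ∀ N : ℕ, ((2 * N + 1 : ℕ) : ℝ) * a β ≤ ℓ₂ →
            ∀ (η : LGConfig 4 G) (y : Fin 4 → ℤ), (n₀ : ℝ) ≤ ‖siteToE y‖ →
              (K (‖siteToE y‖ * a β) + 1) * ‖siteToE y‖ ≤ (N : ℝ) + 1 →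
                ‖siteToE y‖ ^ 8 * |kerCov G r β (fun _ => -(N : ℤ)) (2 * N + 1) η (dens G r 0) (dens G r y)| ≤
                  C₂ / Real.log (1 / (‖siteToE y‖ * a β)) ^ 2) :
    FemtoLogSigR := by
  intro G _ _ _ _ hG
  letI : MeasurableSpace G := borel G
  haveI : BorelSpace G := ⟨rfl⟩
  intro r a ha hlim hpin
  exact femtoLog_of_centred G r a ha hlim (hFBL G hG r a ha hlim hpin) (hcen G hG r a ha hlim hpin)

end Reduction

end Summit.QuantumFields.YangMills.Cruxes.RunningCouplingCeiling.CentredLog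

end
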